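import Summits.QuantumFields.YangMills.Theorems.BalabanUVNodesN15CurvedGluingCubeDressedTwoSided
import HarnessLib

/-!
# Route «BalabanUVNodes» (cluster K4 «SpineRates»), Track-A DAG node N15 = NE2, BACKGROUND LAYER — THE DRESSED CUBE PROPAGATOR FOR BAŁABAN's FULL PERTURBATION `V(A)`: AN ARBITRARY
# EXPONENTIALLY DECAYING PERTURBATION OF THE 1-JET (species (3.52) + averaging words (3.60) + the NONLOCAL `P₁(A)` of (3.76)), `hloc` modulo a defect, two-sided rows

Cell `pub-ymgap`, seat `pub-ymgap-dag-n15-w3` (WIDTH SEAT 3∕3 on node N15, director-ym №197 ∕ HUMAN RULING D-0149; plan `W-SEAT-START-LIST.md` §n15 item 3 «background layers at GENERAL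
small-field U» — twenty-third piece).  `bears_on: R4∕N15 · K3⁷ SpineGivenEndpointR13SepCoPH (stmt-QuantumFields-20544)`.  Filed `--kind proof --supports stmt-QuantumFields-20544 --as helper` —
COUNT-NEUTRAL.  Theorems only; 0 `sorry`.  Imports BY NAME file 21 `…N15CurvedGluingCubeDressedTwoSided` (`mulOp_eq_zero_of_vanish`; file 20 `hasMaj_localize_out`; dag-n15-c B1a `bgPropV`∕
`bgPropV_fix`∕`bgSourceV`∕`bgSourceV_fix`∕`bgPropV_comp`, A1 `isUnit_one_sub_toMatrix'`∕`rowSum_step`, B2 `stack`∕`projO`∕`hasMaj_stack`∕`hasMaj_projO_comp`, FILE 47 `hasMaj_localize`, M-layer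
`unstackM_comp_stack_eq_speciesOpM_comp`; lit `hasMaj_comp_exp`, `neumann_majorant_wrow`); nothing in the tree is modified.

WHY.  Files 16–22 dress a flat cube by the pointwise-multiplier species `V(c, a) = M_c + Σ_μM_{a±μ}∇^±_μ` of (3.52)–(3.53) only.  But at a LIVE background the print's perturbation of
`Δ_a(U) = Δ(U) + D_UR(U)D_U* + Q*(U)aQ(U)` ((3.26) p. 395) is `V(A) = V₁(A) + V₂(A) + P₁(A) + (averaging words)`: (3.60) p. 402 adds the BLOCK-LOCAL words `F₂*aQ + Q*aF₂ + F₂*aF₂`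
(dag-n15-c `avgWord`), (3.71)∕(3.75) pp. 404–405 the local first-order `V₁, V₂`, and (3.76)–(3.77) pp. 405–406 the NONLOCAL `P₁(A)` («a non-local operator whose kernel satisfies the bound
(3.77)», exponentially decaying with the small factor).  All of them act on the 1-jet `(λ, (∇^±_μλ)_μ)`.  So THIS FILE runs the device for an ARBITRARY perturbation `V̂` of the jet with an
exponentially DECAYING block majorant `V̂ ≤ Re^{−δ_Vd}` (pair blocks → base blocks): B1a's `X̂ = (1 − ŜV̂)⁻¹Ŝ`, `Ŝ = (G₀, (D_jG₀)_j)` for any derived pieces `D_j` (forward∕backward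
quotients, covariant derivatives); the identities `X̂ = jet∘X` (`X = pr₀X̂`), `V̂X̂ = 𝒱X` with `𝒱 := V̂∘jet`, `X = G₀(1 + 𝒱X)`, hence `hloc` modulo a defect `M_χ(Δ − 𝒱)X = M_χ + E(1 + 𝒱X)`;
and the majorants by a RECTANGULAR Neumann series with a decaying step (dag-n15-c `hasMaj_bgPropE`'s square argument, two block maps): `X̂ ≤ β(1 − βRc_r²)⁻¹e^{−ρd}`, two-sided localized rows,
right entries.  The species edition of files 20–21 is the case `V̂ = unstackM c a` (`unstackM_comp_stack_eq_speciesOpM_comp`).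

* §1 `stack_eq_jet_comp` (`Ŝ = jet∘G₀`), ★ `projO_none_dressedV` (`X = G₀(1 + V̂X̂)`), ★★ `dressedV_eq_jet_comp` (`X̂ = jet∘X`), `projO_some_dressedV` (`pr_jX̂ = D_j∘X`), `V_comp_dressedV`
  (`V̂X̂ = 𝒱X`), ★★ `mulOp_comp_sub_comp_dressedV_of_defect` (`hloc` modulo `E`), `dressedV_comp_eq_self` (input localization), `speciesOpM_eq_unstackM_comp_jet` (bridge);
* §2 `hasMaj_stepVE`, `isUnit_stepVE`, ★ `hasMaj_bgPropVE`, ★ `hasMaj_bgSourceVE` (rectangular Neumann with a decaying perturbation; the source with its own constant);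
* §3 ★★ `hasMaj_dressedV_pair` (unit ∧ `X̂ ≤ β(1 − βRc_r²)⁻¹e^{−ρd}`), ★★ `hasMaj_dressedV_loc₂` (entry 0, two-sided `1_S1_S`), ★ `hasMaj_projO_dressedV_out` (every component,
  output-localized), ★ `hasMaj_dressedV_comp` (right entries `X̂∘Q ≤ β₂(1 − βRc_r²)⁻¹e^{−ρd}`).

HONEST FRAMING ∕ LIMITS.  Finite-dimensional algebra + Neumann series over DISPLAYED letters: the flat cube `G₀`, its derived pieces and cut-offs, and the perturbation's decay letter
`R, δ_V` — for `P₁(A)` this is (3.77), for the words (3.59)∕(3.81), for the species (3.73): NOT proved here (producers: dag-n15-a ∕ dag-n15-c ∕ the King instances); ONE grid; nothing of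
[B9] asserted ((3.26), (3.52), (3.60)–(3.65), (3.76)–(3.77) = SHAPES ∕ MECHANISM).  NE2⁺ NOT PRINTED, NOT proved; N15 NOT discharged; counts of record UNMOVED (typed 28∕28 · discharged 5∕27);
one finite 𝕋⁴ at fixed ε — NOT infinite volume, NOT OS on ℝ⁴, NOT a mass gap, NOT Clay; R4 closes the conditional finite-𝕋⁴ rung `BalabanLadder.UV` only.  Restate-immune (no Theses import).
-/

set_option autoImplicit false

noncomputable section
open scoped BigOperators
open Finset

namespace Summit.QuantumFields.YangMills.BalabanUVNodes.N15.CurvedSpecies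

open Literature.MathematicalPhysics.QuantumFieldTheory.Balaban1983to89
open Literature.MathematicalPhysics.QuantumFieldTheory.Balaban1983to89.B11SectG (BlockNorm HasMaj RowSum hasMaj_comp_exp)
open Literature.MathematicalPhysics.QuantumFieldTheory.Balaban1983to89.B6RandomWalk (Triangle254)
open Literature.MathematicalPhysics.QuantumFieldTheory.Balaban1983to89.B9SectDWeightedNeumann (WRow wrow_of_exp neumann_majorant_wrow)
open Literature.MathematicalPhysics.QuantumFieldTheory.Balaban1983to89.B6Prop26Gluing (mulOp mulOp_apply ind ind_nonneg ind_of_mem)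
open Summit.QuantumFields.YangMills.BalabanUVNodes.N15.MatrixSpecies (mmulOp liftBlk liftEquiv)
open Summit.QuantumFields.YangMills.BalabanUVNodes.N15.DerivDefect (exists_const_hasMaj_ofBlocks)
open Summit.QuantumFields.YangMills.BalabanUVNodes.N15.BackgroundModel (kappa_ofBlocks)
open Summit.QuantumFields.YangMills.BalabanUVNodes.N15.BackgroundLayer (fgrad bgrad speciesOpM stack projO blkPair hasMaj_stack hasMaj_projO_comp unstackM bgPropV bgPropV_fix bgSourceV
  bgSourceV_fix bgPropV_comp projO_none_comp_stack projO_some_comp_stack isUnit_one_sub_toMatrix' rowSum_step unstackM_comp_stack_eq_speciesOpM_comp)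
open Summit.QuantumFields.YangMills.BalabanUVNodes.N15.Gluing (loc_ofBlocks_eq_zero hasMaj_localize)

/-! ## §1 The pair around a flat cube with an ARBITRARY perturbation of the jet: algebra -/

section Algebra

variable {E : Type} [AddCommGroup E] [Module ℝ E] {Y K : Type} [Fintype Y] [Fintype K] [DecidableEq Y] [DecidableEq K] {G₀ : (Y → ℝ) →ₗ[ℝ] (Y → ℝ)}
  {D Dq : K → (Y → ℝ) →ₗ[ℝ] (Y → ℝ)} {V : (Y × Option K → ℝ) →ₗ[ℝ] (Y → ℝ)}

omit [Fintype Y] [Fintype K] [DecidableEq Y] [DecidableEq K] in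
/-- `Ŝ = jet∘G₀`: the stack of a piece and derived pieces `D_j = Dq_j∘G₀` is the jet map `λ ↦ (λ, (Dq_jλ)_j)` after `G₀`. [folklore] -/
theorem stack_eq_jet_comp (hD : ∀ j, D j = Dq j ∘ₗ G₀) : stack G₀ D = stack LinearMap.id Dq ∘ₗ G₀ := by
  refine LinearMap.ext fun f => funext fun p => ?_
  rcases p with ⟨q, _ | j⟩
  · rfl
  · simp only [LinearMap.comp_apply, BackgroundLayer.stack_apply_some, hD j]

/-- ★ `X = G₀∘(1 + V̂X̂)` — (3.65)'s propagator component for any perturbation of the jet. [cite: Balaban1985BackgroundPropagators, (3.64)–(3.65) pp.402–403 (shape)] -/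
theorem projO_none_dressedV (hunit : IsUnit (1 - LinearMap.toMatrix' (stack G₀ D ∘ₗ V))) :
    projO none ∘ₗ bgPropV (stack G₀ D) V = G₀ ∘ₗ (LinearMap.id + V ∘ₗ bgPropV (stack G₀ D) V) := by
  have hfix := bgPropV_fix hunit
  have h1 : bgPropV (stack G₀ D) V = stack G₀ D ∘ₗ (LinearMap.id + V ∘ₗ bgPropV (stack G₀ D) V) := by
    conv_lhs => rw [hfix]
    rw [LinearMap.comp_add, LinearMap.comp_id, LinearMap.comp_assoc]
  conv_lhs => rw [h1]
  rw [← LinearMap.comp_assoc, projO_none_comp_stack]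

/-- ★★ `X̂ = jet∘X`: every component of the pair is the corresponding derived piece of the propagator component. [cite: Balaban1985BackgroundPropagators, (3.65) p.403 (mechanism); King1986, Prop. 3.9 (3.73) p.665 (separate derivative kernels: shape)] -/
theorem dressedV_eq_jet_comp (hD : ∀ j, D j = Dq j ∘ₗ G₀) (hunit : IsUnit (1 - LinearMap.toMatrix' (stack G₀ D ∘ₗ V))) :
    bgPropV (stack G₀ D) V = stack LinearMap.id Dq ∘ₗ (projO none ∘ₗ bgPropV (stack G₀ D) V) := by
  have hfix := bgPropV_fix hunit
  rw [projO_none_dressedV hunit, ← LinearMap.comp_assoc, ← stack_eq_jet_comp hD]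
  conv_lhs => rw [hfix]
  rw [LinearMap.comp_add, LinearMap.comp_id, LinearMap.comp_assoc]

/-- `pr_jX̂ = Dq_j∘X`. [cite: King1986, Prop. 3.9 (3.73) p.665 (shape)] -/
theorem projO_some_dressedV (hD : ∀ j, D j = Dq j ∘ₗ G₀) (hunit : IsUnit (1 - LinearMap.toMatrix' (stack G₀ D ∘ₗ V))) (j : K) :
    projO (some j) ∘ₗ bgPropV (stack G₀ D) V = Dq j ∘ₗ (projO none ∘ₗ bgPropV (stack G₀ D) V) := by
  conv_lhs => rw [dressedV_eq_jet_comp hD hunit]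
  rw [← LinearMap.comp_assoc, projO_some_comp_stack]

/-- `V̂∘X̂ = 𝒱∘X` with the base operator `𝒱 := V̂∘jet`. [cite: Balaban1985BackgroundPropagators, (3.62)–(3.63) p.402 («V′(A)G′(U)»: shape)] -/
theorem V_comp_dressedV (hD : ∀ j, D j = Dq j ∘ₗ G₀) (hunit : IsUnit (1 - LinearMap.toMatrix' (stack G₀ D ∘ₗ V))) :
    V ∘ₗ bgPropV (stack G₀ D) V = (V ∘ₗ stack LinearMap.id Dq) ∘ₗ (projO none ∘ₗ bgPropV (stack G₀ D) V) := by
  conv_lhs => rw [dressedV_eq_jet_comp hD hunit]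
  rw [LinearMap.comp_assoc]

/-- ★★ **`hloc` MODULO A DEFECT, GENERAL PERTURBATION**: `M_χΔG₀ = M_χ + E` ⟹ `M_χ∘(Δ − 𝒱)∘X = M_χ + E∘(1 + 𝒱∘X)`, `𝒱 = V̂∘jet`. [cite: Balaban1984PropagatorsII, (2.91) p.239 (mechanism); Balaban1985BackgroundPropagators, (3.62)–(3.65) pp.402–403, (3.76) p.405] -/
theorem mulOp_comp_sub_comp_dressedV_of_defect (Δ Ed : (Y → ℝ) →ₗ[ℝ] (Y → ℝ)) (χ : Y → ℝ) (hloc : mulOp χ ∘ₗ Δ ∘ₗ G₀ = mulOp χ + Ed) (hD : ∀ j, D j = Dq j ∘ₗ G₀)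
    (hunit : IsUnit (1 - LinearMap.toMatrix' (stack G₀ D ∘ₗ V))) :
    mulOp χ ∘ₗ (Δ - V ∘ₗ stack LinearMap.id Dq) ∘ₗ (projO none ∘ₗ bgPropV (stack G₀ D) V) =
      mulOp χ + Ed ∘ₗ (LinearMap.id + (V ∘ₗ stack LinearMap.id Dq) ∘ₗ (projO none ∘ₗ bgPropV (stack G₀ D) V)) := by
  have hX := projO_none_dressedV (G₀ := G₀) (D := D) hunit
  have hVX := V_comp_dressedV hD hunit
  rw [hVX] at hX
  have hassoc : mulOp χ ∘ₗ Δ ∘ₗ (G₀ ∘ₗ (LinearMap.id + (V ∘ₗ stack LinearMap.id Dq) ∘ₗ (projO none ∘ₗ bgPropV (stack G₀ D) V))) =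
      (mulOp χ ∘ₗ Δ ∘ₗ G₀) ∘ₗ (LinearMap.id + (V ∘ₗ stack LinearMap.id Dq) ∘ₗ (projO none ∘ₗ bgPropV (stack G₀ D) V)) := by
    simp only [LinearMap.comp_assoc]
  have h1 : mulOp χ ∘ₗ Δ ∘ₗ (projO none ∘ₗ bgPropV (stack G₀ D) V) =
      (mulOp χ + Ed) ∘ₗ (LinearMap.id + (V ∘ₗ stack LinearMap.id Dq) ∘ₗ (projO none ∘ₗ bgPropV (stack G₀ D) V)) := by
    conv_lhs => rw [hX]
    rw [hassoc, hloc]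
  rw [LinearMap.sub_comp, LinearMap.comp_sub, h1, LinearMap.add_comp, LinearMap.comp_add, LinearMap.comp_id]
  abel

omit [Fintype K] [DecidableEq K] in
/-- INPUT LOCALIZATION IS INHERITED: `G₀∘Q = G₀` (and `D_j = Dq_j∘G₀`) ⟹ `X̂∘Q = X̂`. [cite: Balaban1984PropagatorsII, (2.133) p.247 (shape)] -/
theorem dressedV_comp_eq_self [Fintype K] [DecidableEq K] (hD : ∀ j, D j = Dq j ∘ₗ G₀) {Q : (Y → ℝ) →ₗ[ℝ] (Y → ℝ)} (hG : G₀ ∘ₗ Q = G₀) :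
    bgPropV (stack G₀ D) V ∘ₗ Q = bgPropV (stack G₀ D) V := by
  have hS : stack G₀ D ∘ₗ Q = stack G₀ D := by rw [stack_eq_jet_comp hD, LinearMap.comp_assoc, hG]
  rw [bgPropV_comp, hS]
  rfl

end Algebra

section Bridge

variable {X ι J : Type} [Fintype X] [DecidableEq X] [Fintype ι] [DecidableEq ι] [Fintype J] [DecidableEq J] (τ : J → X ≃ X) (n : ℝ) (C : X → Matrix ι ι ℝ)
  (A : J ⊕ J → X → Matrix ι ι ℝ)

omit [Fintype X] [DecidableEq X] [DecidableEq ι] [DecidableEq J] in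
/-- BRIDGE: the species edition (files 20–21) is the case `V̂ = unstackM c a` — `unstackM c a ∘ jet = V(c, a)`. [cite: Balaban1985BackgroundPropagators, (3.52) p.400 (shape)] -/
theorem speciesOpM_eq_unstackM_comp_jet :
    speciesOpM τ n C A = unstackM C A ∘ₗ stack LinearMap.id (fun j : J ⊕ J => Sum.elim (fun μ => fgrad n (liftEquiv (τ μ) ι)) (fun μ => bgrad n (liftEquiv (τ μ) ι)) j) := by
  rw [unstackM_comp_stack_eq_speciesOpM_comp τ n LinearMap.id C A (fun μ => by rw [Sum.elim_inl, LinearMap.comp_id]) (fun μ => by rw [Sum.elim_inr, LinearMap.comp_id]),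
    LinearMap.comp_id]

end Bridge

/-! ## §2 Rectangular Neumann with an exponentially decaying perturbation -/

section Neumann

variable {X₁ X₂ : Type} [Fintype X₁] [Fintype X₂] [DecidableEq X₁] [DecidableEq X₂] {g : B6.Geometry} (blk₁ : X₁ → g.Site) (blk₂ : X₂ → g.Site) {σ cr : ℝ}
  {G S : (X₁ → ℝ) →ₗ[ℝ] (X₂ → ℝ)} {V : (X₂ → ℝ) →ₗ[ℝ] (X₁ → ℝ)} {β β₂ δ R δV : ℝ}

omit [DecidableEq X₁] [DecidableEq X₂] in
/-- THE STEP `Ĝ∘V̂ ≤ βRc_r·e^{−ρ₁d}` for `Ĝ ≤ βe^{−δd}`, `V̂ ≤ Re^{−δ_Vd}`, `0 ≤ ρ₁ ≤ δ_V`, `ρ₁ + σ ≤ δ`. [cite: Balaban1985BackgroundPropagators, (3.63) p.402, (3.77) p.406 (shapes); Balaban1984PropagatorsII, (2.52)–(2.56)] -/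
theorem hasMaj_stepVE (htri : Triangle254 g) (hd : ∀ a b : g.Site, 0 ≤ g.dist a b) (hrow : RowSum g σ cr) (hβ : 0 ≤ β) (hR : 0 ≤ R) {ρ₁ : ℝ} (hρ₁ : 0 ≤ ρ₁) (hρ₁V : ρ₁ ≤ δV)
    (hρ₁G : ρ₁ + σ ≤ δ) (hG : HasMaj (BlockNorm.ofBlocks g blk₁) (BlockNorm.ofBlocks g blk₂) G (fun y y' => β * Real.exp (-(δ * g.dist y y'))))
    (hV : HasMaj (BlockNorm.ofBlocks g blk₂) (BlockNorm.ofBlocks g blk₁) V (fun y y' => R * Real.exp (-(δV * g.dist y y')))) :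
    HasMaj (BlockNorm.ofBlocks g blk₂) (BlockNorm.ofBlocks g blk₂) (G ∘ₗ V) (fun y y' => β * R * cr * Real.exp (-(ρ₁ * g.dist y y'))) := by
  refine (hasMaj_comp_exp htri hd hrow hβ hR hρ₁ hρ₁V hρ₁G hG hV).mono fun a b => le_of_eq ?_
  rw [kappa_ofBlocks]
  ring

omit [DecidableEq X₁] in
/-- `1 − [Ĝ∘V̂]` IS A UNIT when `βRc_r² < 1`. [cite: Balaban1985BackgroundPropagators, (3.64) p.403, (3.67) p.403 (mechanism)] -/
theorem isUnit_stepVE (htri : Triangle254 g) (hd : ∀ a b : g.Site, 0 ≤ g.dist a b) (hrow : RowSum g σ cr) (hσ : 0 ≤ σ) (hβ : 0 ≤ β) (hR : 0 ≤ R) (hcr : 0 ≤ cr) {ρ₁ : ℝ}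
    (hσρ : σ ≤ ρ₁) (hρ₁V : ρ₁ ≤ δV) (hρ₁G : ρ₁ + σ ≤ δ)
    (hG : HasMaj (BlockNorm.ofBlocks g blk₁) (BlockNorm.ofBlocks g blk₂) G (fun y y' => β * Real.exp (-(δ * g.dist y y'))))
    (hV : HasMaj (BlockNorm.ofBlocks g blk₂) (BlockNorm.ofBlocks g blk₁) V (fun y y' => R * Real.exp (-(δV * g.dist y y')))) (hq : β * (R * cr) * cr < 1) :
    IsUnit (1 - LinearMap.toMatrix' (G ∘ₗ V)) := by
  have hK := hasMaj_stepVE blk₁ blk₂ htri hd hrow hβ hR (hσ.trans hσρ) hρ₁V hρ₁G hG hV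
  have hK' : HasMaj (BlockNorm.ofBlocks g blk₂) (BlockNorm.ofBlocks g blk₂) (G ∘ₗ V) (fun y y' => β * (R * cr) * Real.exp (-(ρ₁ * g.dist y y'))) :=
    hK.mono fun a b => le_of_eq (by ring)
  exact isUnit_one_sub_toMatrix' hK' (fun _ _ => mul_nonneg (mul_nonneg hβ (mul_nonneg hR hcr)) (Real.exp_nonneg _))
    (rowSum_step hd hrow hσρ hβ (mul_nonneg hR hcr)) hq

/-- ★ **RECTANGULAR NEUMANN WITH A DECAYING PERTURBATION, SOURCE WITH ITS OWN CONSTANT**: `Ŝ ≤ β₂e^{−δd}` ⟹ `bgSourceV Ĝ Ŝ V̂ ≤ β₂(1 − βRc_r²)⁻¹e^{−ρ₂d}` (`ρ₂ + σ ≤ ρ₁`).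
[cite: Balaban1985BackgroundPropagators, (3.64)–(3.67) p.403 (mechanism); Balaban1984PropagatorsII, (2.52)–(2.56) pp.232–233] -/
theorem hasMaj_bgSourceVE (htri : Triangle254 g) (hd : ∀ a b : g.Site, 0 ≤ g.dist a b) (hrow : RowSum g σ cr) (hσ : 0 ≤ σ) (hβ : 0 ≤ β) (hβ₂ : 0 ≤ β₂) (hR : 0 ≤ R)
    (hcr : 0 ≤ cr) {ρ₁ ρ₂ : ℝ} (hσρ : σ ≤ ρ₁) (hρ₁V : ρ₁ ≤ δV) (hρ₁G : ρ₁ + σ ≤ δ) (hρ₂ : 0 ≤ ρ₂) (hρ₂₁ : ρ₂ + σ ≤ ρ₁)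
    (hG : HasMaj (BlockNorm.ofBlocks g blk₁) (BlockNorm.ofBlocks g blk₂) G (fun y y' => β * Real.exp (-(δ * g.dist y y'))))
    (hS : HasMaj (BlockNorm.ofBlocks g blk₁) (BlockNorm.ofBlocks g blk₂) S (fun y y' => β₂ * Real.exp (-(δ * g.dist y y'))))
    (hV : HasMaj (BlockNorm.ofBlocks g blk₂) (BlockNorm.ofBlocks g blk₁) V (fun y y' => R * Real.exp (-(δV * g.dist y y')))) (hq : β * (R * cr) * cr < 1) :
    HasMaj (BlockNorm.ofBlocks g blk₁) (BlockNorm.ofBlocks g blk₂) (bgSourceV G S V) (fun y y' => β₂ * (1 - β * (R * cr) * cr)⁻¹ * Real.exp (-(ρ₂ * g.dist y y'))) := by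
  have hρ₁ : 0 ≤ ρ₁ := hσ.trans hσρ
  have hfix := bgSourceV_fix (S := S) (isUnit_stepVE blk₁ blk₂ htri hd hrow hσ hβ hR hcr hσρ hρ₁V hρ₁G hG hV hq)
  have hK : HasMaj (BlockNorm.ofBlocks g blk₂) (BlockNorm.ofBlocks g blk₂) (G ∘ₗ V) (fun y y' => β * (R * cr) * Real.exp (-(ρ₁ * g.dist y y'))) :=
    (hasMaj_stepVE blk₁ blk₂ htri hd hrow hβ hR hρ₁ hρ₁V hρ₁G hG hV).mono fun a b => le_of_eq (by ring)
  have hwrow : WRow g ρ₂ (fun y y' => β * (R * cr) * Real.exp (-(ρ₁ * g.dist y y'))) (β * (R * cr) * cr) :=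
    wrow_of_exp hd hrow (mul_nonneg hβ (mul_nonneg hR hcr)) hρ₂₁
  have hS' : HasMaj (BlockNorm.ofBlocks g blk₁) (BlockNorm.ofBlocks g blk₂) S (fun y y' => β₂ * Real.exp (-(ρ₂ * g.dist y y'))) :=
    hS.mono fun a b => mul_le_mul_of_nonneg_left (Real.exp_le_exp.mpr (by nlinarith [hd a b])) hβ₂
  obtain ⟨M₀, hM₀, hap⟩ := exists_const_hasMaj_ofBlocks (g := g) blk₁ blk₂ (bgSourceV G S V)
  have hq1 : (BlockNorm.ofBlocks g blk₂).κ * (β * (R * cr) * cr) < 1 := by rw [kappa_ofBlocks, one_mul]; exact hq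
  have key := neumann_majorant_wrow htri hd hρ₂ (fun _ _ => mul_nonneg (mul_nonneg hβ (mul_nonneg hR hcr)) (Real.exp_nonneg _)) hwrow hβ₂ hM₀ hK hS' hfix hap hq1
  refine key.mono fun a b => le_of_eq ?_
  rw [kappa_ofBlocks, one_mul]

/-- ★ **RECTANGULAR NEUMANN WITH A DECAYING PERTURBATION**: `bgPropV Ĝ V̂ ≤ β(1 − βRc_r²)⁻¹e^{−ρ₂d}` (the source `Ŝ = Ĝ`). [cite: Balaban1985BackgroundPropagators, (3.64) p.403 (mechanism)] -/
theorem hasMaj_bgPropVE (htri : Triangle254 g) (hd : ∀ a b : g.Site, 0 ≤ g.dist a b) (hrow : RowSum g σ cr) (hσ : 0 ≤ σ) (hβ : 0 ≤ β) (hR : 0 ≤ R) (hcr : 0 ≤ cr) {ρ₁ ρ₂ : ℝ}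
    (hσρ : σ ≤ ρ₁) (hρ₁V : ρ₁ ≤ δV) (hρ₁G : ρ₁ + σ ≤ δ) (hρ₂ : 0 ≤ ρ₂) (hρ₂₁ : ρ₂ + σ ≤ ρ₁)
    (hG : HasMaj (BlockNorm.ofBlocks g blk₁) (BlockNorm.ofBlocks g blk₂) G (fun y y' => β * Real.exp (-(δ * g.dist y y'))))
    (hV : HasMaj (BlockNorm.ofBlocks g blk₂) (BlockNorm.ofBlocks g blk₁) V (fun y y' => R * Real.exp (-(δV * g.dist y y')))) (hq : β * (R * cr) * cr < 1) :
    HasMaj (BlockNorm.ofBlocks g blk₁) (BlockNorm.ofBlocks g blk₂) (bgPropV G V) (fun y y' => β * (1 - β * (R * cr) * cr)⁻¹ * Real.exp (-(ρ₂ * g.dist y y'))) :=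
  hasMaj_bgSourceVE blk₁ blk₂ htri hd hrow hσ hβ hβ hR hcr hσρ hρ₁V hρ₁G hρ₂ hρ₂₁ hG hG hV hq

end Neumann

/-! ## §3 The dressed cube pair with a decaying perturbation of the jet: rows -/

section Rows

variable {X ι J : Type} [Fintype X] [DecidableEq X] [Fintype ι] [DecidableEq ι] [Fintype J] [DecidableEq J] {G₀ : (X × ι → ℝ) →ₗ[ℝ] (X × ι → ℝ)}
  {D Dq : J ⊕ J → (X × ι → ℝ) →ₗ[ℝ] (X × ι → ℝ)} {V : ((X × ι) × Option (J ⊕ J) → ℝ) →ₗ[ℝ] (X × ι → ℝ)} {g : B6.Geometry} (blk : X → g.Site) {σ cr : ℝ}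

/-- ★★ **THE PAIR WITH A DECAYING PERTURBATION**: `G₀, D_j ≤ βe^{−δd}`, `V̂ ≤ Re^{−δ_Vd}` (pair blocks → base blocks), `σ ≤ ρ₁ ≤ δ_V`, `ρ₁ + σ ≤ δ`, `ρ₂ + σ ≤ ρ₁`, `βRc_r² < 1` ⟹ the unit holds
and `X̂ ≤ β(1 − βRc_r²)⁻¹e^{−ρ₂d}`. [cite: Balaban1985BackgroundPropagators, (3.63)–(3.64) pp.402–403, (3.76)–(3.77) pp.405–406 (mechanism + the nonlocal letter's shape)] -/
theorem hasMaj_dressedV_pair (htri : Triangle254 g) (hd : ∀ a b : g.Site, 0 ≤ g.dist a b) (hrow : RowSum g σ cr) (hσ : 0 ≤ σ) {ρ₁ ρ₂ δ δV β R : ℝ} (hβ : 0 ≤ β) (hR : 0 ≤ R)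
    (hcr : 0 ≤ cr) (hσρ : σ ≤ ρ₁) (hρ₁V : ρ₁ ≤ δV) (hρ₁G : ρ₁ + σ ≤ δ) (hρ₂ : 0 ≤ ρ₂) (hρ₂₁ : ρ₂ + σ ≤ ρ₁)
    (hG : HasMaj (BlockNorm.ofBlocks g (liftBlk blk ι)) (BlockNorm.ofBlocks g (liftBlk blk ι)) G₀ (fun y y' => β * Real.exp (-(δ * g.dist y y'))))
    (hD : ∀ j, HasMaj (BlockNorm.ofBlocks g (liftBlk blk ι)) (BlockNorm.ofBlocks g (liftBlk blk ι)) (D j) (fun y y' => β * Real.exp (-(δ * g.dist y y'))))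
    (hV : HasMaj (BlockNorm.ofBlocks g (blkPair (liftBlk blk ι))) (BlockNorm.ofBlocks g (liftBlk blk ι)) V (fun y y' => R * Real.exp (-(δV * g.dist y y'))))
    (hq : β * (R * cr) * cr < 1) :
    IsUnit (1 - LinearMap.toMatrix' (stack G₀ D ∘ₗ V)) ∧
      HasMaj (BlockNorm.ofBlocks g (liftBlk blk ι)) (BlockNorm.ofBlocks g (blkPair (liftBlk blk ι))) (bgPropV (stack G₀ D) V)
        (fun y y' => β * (1 - β * (R * cr) * cr)⁻¹ * Real.exp (-(ρ₂ * g.dist y y'))) := by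
  have hS := hasMaj_stack (liftBlk blk ι) (fun _ _ => mul_nonneg hβ (Real.exp_nonneg _)) hG hD
  exact ⟨isUnit_stepVE (liftBlk blk ι) (blkPair (liftBlk blk ι)) htri hd hrow hσ hβ hR hcr hσρ hρ₁V hρ₁G hS hV hq,
    hasMaj_bgPropVE (liftBlk blk ι) (blkPair (liftBlk blk ι)) htri hd hrow hσ hβ hR hcr hσρ hρ₁V hρ₁G hρ₂ hρ₂₁ hS hV hq⟩

/-- ★ **EVERY COMPONENT, OUTPUT-LOCALIZED**: `pr_jX̂ = (pr_jŜ)∘(1 + V̂X̂)`, so an output cut-off of the flat component `M_ψ∘pr_jŜ = pr_jŜ` (`supp ψ` over `S`) passes to the dressed one: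
`pr_jX̂ ≤ 1_S(y)·β(1 − βRc_r²)⁻¹e^{−ρ₂d}`. [cite: Balaban1984PropagatorsII, (2.133) p.247 (shape); Balaban1985BackgroundPropagators, (3.65) p.403 (mechanism)] -/
theorem hasMaj_projO_dressedV_out (htri : Triangle254 g) (hd : ∀ a b : g.Site, 0 ≤ g.dist a b) (hrow : RowSum g σ cr) (hσ : 0 ≤ σ) {ρ₁ ρ₂ δ δV β R : ℝ} (hβ : 0 ≤ β)
    (hR : 0 ≤ R) (hcr : 0 ≤ cr) (hσρ : σ ≤ ρ₁) (hρ₁V : ρ₁ ≤ δV) (hρ₁G : ρ₁ + σ ≤ δ) (hρ₂ : 0 ≤ ρ₂) (hρ₂₁ : ρ₂ + σ ≤ ρ₁) (j : Option (J ⊕ J)) {S : Set g.Site} {ψX : X → ℝ}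
    (hSψ : ∀ x, ψX x ≠ 0 → blk x ∈ S) (hψ : mulOp (fun p : X × ι => ψX p.1) ∘ₗ (projO j ∘ₗ stack G₀ D) = projO j ∘ₗ stack G₀ D)
    (hG : HasMaj (BlockNorm.ofBlocks g (liftBlk blk ι)) (BlockNorm.ofBlocks g (liftBlk blk ι)) G₀ (fun y y' => β * Real.exp (-(δ * g.dist y y'))))
    (hD : ∀ j, HasMaj (BlockNorm.ofBlocks g (liftBlk blk ι)) (BlockNorm.ofBlocks g (liftBlk blk ι)) (D j) (fun y y' => β * Real.exp (-(δ * g.dist y y'))))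
    (hV : HasMaj (BlockNorm.ofBlocks g (blkPair (liftBlk blk ι))) (BlockNorm.ofBlocks g (liftBlk blk ι)) V (fun y y' => R * Real.exp (-(δV * g.dist y y'))))
    (hq : β * (R * cr) * cr < 1) :
    HasMaj (BlockNorm.ofBlocks g (liftBlk blk ι)) (BlockNorm.ofBlocks g (liftBlk blk ι)) (projO j ∘ₗ bgPropV (stack G₀ D) V)
      (fun y y' => ind S y * (β * (1 - β * (R * cr) * cr)⁻¹ * Real.exp (-(ρ₂ * g.dist y y')))) := by
  obtain ⟨hunit, hX⟩ := hasMaj_dressedV_pair blk htri hd hrow hσ hβ hR hcr hσρ hρ₁V hρ₁G hρ₂ hρ₂₁ hG hD hV hq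
  have hβX : 0 ≤ β * (1 - β * (R * cr) * cr)⁻¹ := mul_nonneg hβ (inv_nonneg.2 (by linarith))
  have hfix := bgPropV_fix hunit
  have hfac : projO j ∘ₗ bgPropV (stack G₀ D) V = (projO j ∘ₗ stack G₀ D) ∘ₗ (LinearMap.id + V ∘ₗ bgPropV (stack G₀ D) V) := by
    conv_lhs => rw [hfix]
    rw [LinearMap.comp_add, LinearMap.comp_add, LinearMap.comp_id, LinearMap.comp_assoc, LinearMap.comp_assoc]
  refine hasMaj_localize_out blk (fun a b => mul_nonneg hβX (Real.exp_nonneg _)) (fun μ p hp => ?_) (hasMaj_projO_comp (liftBlk blk ι) hX j)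
  have hψ0 : ψX p.1 = 0 := by by_contra h; exact hp (hSψ p.1 h)
  rw [hfac, ← hψ]
  simp only [LinearMap.comp_apply, mulOp_apply, hψ0, zero_mul]

/-- ★★ **ENTRY 0, TWO-SIDED LOCALIZED, DECAYING PERTURBATION** (FILE 55's `hG` shape for the cube dressed by the FULL `V(A)`): `G₀ = M_χG₀ = G₀M_ψ` over `S`, `D_j = Dq_j∘G₀` ⟹
`pr₀X̂ ≤ 1_S(y)1_S(y′)·β(1 − βRc_r²)⁻¹e^{−ρ₂d}`. [cite: Balaban1984PropagatorsII, (2.133) p.247 (shape); Balaban1985BackgroundPropagators, (3.65) p.403, (3.76)–(3.77) pp.405–406] -/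
theorem hasMaj_dressedV_loc₂ (htri : Triangle254 g) (hd : ∀ a b : g.Site, 0 ≤ g.dist a b) (hrow : RowSum g σ cr) (hσ : 0 ≤ σ) {ρ₁ ρ₂ δ δV β R : ℝ} (hβ : 0 ≤ β) (hR : 0 ≤ R)
    (hcr : 0 ≤ cr) (hσρ : σ ≤ ρ₁) (hρ₁V : ρ₁ ≤ δV) (hρ₁G : ρ₁ + σ ≤ δ) (hρ₂ : 0 ≤ ρ₂) (hρ₂₁ : ρ₂ + σ ≤ ρ₁) {S : Set g.Site} {χX ψX : X → ℝ}
    (hSχ : ∀ x, χX x ≠ 0 → blk x ∈ S) (hSψ : ∀ x, ψX x ≠ 0 → blk x ∈ S) (hGχ : mulOp (fun p : X × ι => χX p.1) ∘ₗ G₀ = G₀)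
    (hGψ : G₀ ∘ₗ mulOp (fun p : X × ι => ψX p.1) = G₀) (hDq : ∀ j, D j = Dq j ∘ₗ G₀)
    (hG : HasMaj (BlockNorm.ofBlocks g (liftBlk blk ι)) (BlockNorm.ofBlocks g (liftBlk blk ι)) G₀ (fun y y' => β * Real.exp (-(δ * g.dist y y'))))
    (hD : ∀ j, HasMaj (BlockNorm.ofBlocks g (liftBlk blk ι)) (BlockNorm.ofBlocks g (liftBlk blk ι)) (D j) (fun y y' => β * Real.exp (-(δ * g.dist y y'))))
    (hV : HasMaj (BlockNorm.ofBlocks g (blkPair (liftBlk blk ι))) (BlockNorm.ofBlocks g (liftBlk blk ι)) V (fun y y' => R * Real.exp (-(δV * g.dist y y'))))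
    (hq : β * (R * cr) * cr < 1) :
    HasMaj (BlockNorm.ofBlocks g (liftBlk blk ι)) (BlockNorm.ofBlocks g (liftBlk blk ι)) (projO none ∘ₗ bgPropV (stack G₀ D) V)
      (fun y y' => ind S y * ind S y' * (β * (1 - β * (R * cr) * cr)⁻¹ * Real.exp (-(ρ₂ * g.dist y y')))) := by
  obtain ⟨hunit, hX⟩ := hasMaj_dressedV_pair blk htri hd hrow hσ hβ hR hcr hσρ hρ₁V hρ₁G hρ₂ hρ₂₁ hG hD hV hq
  have hβX : 0 ≤ β * (1 - β * (R * cr) * cr)⁻¹ := mul_nonneg hβ (inv_nonneg.2 (by linarith))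
  have hfac := projO_none_dressedV (G₀ := G₀) (D := D) (V := V) hunit
  have hinp := dressedV_comp_eq_self (V := V) hDq hGψ
  refine hasMaj_localize (liftBlk blk ι) (liftBlk blk ι) (fun a b => mul_nonneg hβX (Real.exp_nonneg _)) (fun μ p hp => ?_) (fun μ hμ => ?_)
    (hasMaj_projO_comp (liftBlk blk ι) hX none)
  · have hχ0 : χX p.1 = 0 := by by_contra h; exact hp (hSχ p.1 h)
    rw [hfac, ← hGχ]
    simp only [LinearMap.comp_apply, mulOp_apply, hχ0, zero_mul]
  · rw [LinearMap.comp_apply, ← hinp, LinearMap.comp_apply, mulOp_eq_zero_of_vanish blk hSψ μ hμ, map_zero, map_zero]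

/-- ★ **RIGHT ENTRIES, DECAYING PERTURBATION**: `G₀∘Q, D_j∘Q ≤ β₂e^{−δd}` ⟹ `X̂∘Q ≤ β₂(1 − βRc_r²)⁻¹e^{−ρ₂d}` (B1a `bgPropV_comp`: `X̂∘Q = bgSourceV Ŝ (Ŝ∘Q) V̂`).
[cite: Balaban1985BackgroundPropagators, (3.42) p.397 (entry 2: shape), (3.64)–(3.65) pp.402–403 (mechanism)] -/
theorem hasMaj_dressedV_comp (htri : Triangle254 g) (hd : ∀ a b : g.Site, 0 ≤ g.dist a b) (hrow : RowSum g σ cr) (hσ : 0 ≤ σ) {ρ₁ ρ₂ δ δV β β₂ R : ℝ} (hβ : 0 ≤ β)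
    (hβ₂ : 0 ≤ β₂) (hR : 0 ≤ R) (hcr : 0 ≤ cr) (hσρ : σ ≤ ρ₁) (hρ₁V : ρ₁ ≤ δV) (hρ₁G : ρ₁ + σ ≤ δ) (hρ₂ : 0 ≤ ρ₂) (hρ₂₁ : ρ₂ + σ ≤ ρ₁)
    (Q : (X × ι → ℝ) →ₗ[ℝ] (X × ι → ℝ))
    (hG : HasMaj (BlockNorm.ofBlocks g (liftBlk blk ι)) (BlockNorm.ofBlocks g (liftBlk blk ι)) G₀ (fun y y' => β * Real.exp (-(δ * g.dist y y'))))
    (hD : ∀ j, HasMaj (BlockNorm.ofBlocks g (liftBlk blk ι)) (BlockNorm.ofBlocks g (liftBlk blk ι)) (D j) (fun y y' => β * Real.exp (-(δ * g.dist y y'))))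
    (hGQ : HasMaj (BlockNorm.ofBlocks g (liftBlk blk ι)) (BlockNorm.ofBlocks g (liftBlk blk ι)) (G₀ ∘ₗ Q) (fun y y' => β₂ * Real.exp (-(δ * g.dist y y'))))
    (hDQ : ∀ j, HasMaj (BlockNorm.ofBlocks g (liftBlk blk ι)) (BlockNorm.ofBlocks g (liftBlk blk ι)) (D j ∘ₗ Q) (fun y y' => β₂ * Real.exp (-(δ * g.dist y y'))))
    (hV : HasMaj (BlockNorm.ofBlocks g (blkPair (liftBlk blk ι))) (BlockNorm.ofBlocks g (liftBlk blk ι)) V (fun y y' => R * Real.exp (-(δV * g.dist y y'))))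
    (hq : β * (R * cr) * cr < 1) :
    HasMaj (BlockNorm.ofBlocks g (liftBlk blk ι)) (BlockNorm.ofBlocks g (blkPair (liftBlk blk ι))) (bgPropV (stack G₀ D) V ∘ₗ Q)
      (fun y y' => β₂ * (1 - β * (R * cr) * cr)⁻¹ * Real.exp (-(ρ₂ * g.dist y y'))) := by
  have hS := hasMaj_stack (liftBlk blk ι) (fun _ _ => mul_nonneg hβ (Real.exp_nonneg _)) hG hD
  have hSQ := hasMaj_stack (liftBlk blk ι) (fun _ _ => mul_nonneg hβ₂ (Real.exp_nonneg _)) hGQ hDQ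
  have hst : stack G₀ D ∘ₗ Q = stack (G₀ ∘ₗ Q) (fun j => D j ∘ₗ Q) :=
    LinearMap.ext fun v => funext fun p => by rcases p with ⟨y, _ | j⟩ <;> rfl
  rw [bgPropV_comp, hst]
  exact hasMaj_bgSourceVE (liftBlk blk ι) (blkPair (liftBlk blk ι)) htri hd hrow hσ hβ hβ₂ hR hcr hσρ hρ₁V hρ₁G hρ₂ hρ₂₁ hS hSQ hV hq

end Rows

end Summit.QuantumFields.YangMills.BalabanUVNodes.N15.CurvedSpecies

end
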